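import Literature.AlgebraicGeometry.Frobenioids.ArchimedeanNotIsoSubanchorAngular
import HarnessLib

/-!
# Frobenioids II, Proposition 3.5 (ii), the direction «iso-subanchor ⇒ non-isotropic» ([FrdI] Remark
# 3.1.1 "an iso-subanchor of the Frobenioid is never isotropic") — PROVED for `C = C^ℤ` and for `A`

Mochizuki, *The geometry of Frobenioids II*, Kyushu J. Math. **62** (2008) 401–460, §3, Prop. 3.5 (ii),
kurims text p. 34 [cite: MochizukiFrdII2008, Prop 3.5 (ii) p.34]: "The Frobenioid `F` is quasi-isotropic,
i.e., an object of `F` is non-isotropic if and only if it is an iso-subanchor of `F`"; proof p. 34: "By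
[FrdI], Remark 3.1.1, it suffices to show that every non-isotropic `A ∈ Ob(F)` is an iso-subanchor" —
i.e. the implication «iso-subanchor ⇒ non-isotropic» is [FrdI] Rmk. 3.1.1: "An iso-subanchor of the
Frobenioid `C` is never isotropic. … Indeed, by Proposition 1.10 (iv), an anchor is never isotropic.
Thus, by Definition 1.3 (vii)(b), a subanchor is never isotropic. Now if `B → A` is a mono-minimal
categorical quotient … such that `B` is a subanchor and `A` is isotropic, then … `B` is isotropic — a
contradiction."

This file PROVES that implication for `F = C` and `F = A` of Example 3.3 over a totally epimorphic base
`D` (explicitly, from `ArchimedeanIsotropicAnchors` / `ArchimedeanNotIsoSubanchorC` / `…Angular`: isotropic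
objects are not anchors — prime-degree Frobenius-type arrows —, isotropy propagates along arrows, and the
hull argument for mono-minimal quotients): `isoSubanchor_not_isotropic_C`, `isoSubanchor_not_isotropic_A`,
stated with [FrdI]'s `IsIsotropic` via abc-iut-L1-t6's `Ex33ii/iii_isotropic_iff_holds`. The converse
direction of (ii) («non-isotropic ⇒ iso-subanchor», which uses Prop. 3.5 (i) and the RC-iso-subanchor
hypothesis on `D`) is NOT proved here. No statement of the paper is strengthened; nothing here bears on
[IUTchIII].
-/

namespace Literature.AlgebraicGeometry.Frobenioids

open CategoryTheory

noncomputable section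

universe v u

namespace ArchFrd

variable {D : Type u} [Category.{v} D] (π : D ⥤ D0)

/-! ### `F = C` -/

/-- Different prime degrees give non-isomorphic objects under `X` (in `C` itself).
[cite: MochizukiFrdII2008, Prop 3.5 (ii) p.34] -/
theorem eq_of_under_iso_C (X : C π) {p q : ℕ+} (hp : (p : ℕ).Prime) (hq : (q : ℕ).Prime)
    (e : Under.mk (frobHom π X p) ≅ Under.mk (frobHom π X q)) : p = q := by
  have w := Under.w e.hom
  have hd := congrArg (fun k => (C0.degFr k.fst : ℕ)) w
  change (C0.degFr ((frobHom π X p) ≫ e.hom.right).fst : ℕ) = (C0.degFr (frobHom π X q).fst : ℕ) at hd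
  rw [CFP.comp_fst, C0.degFr_comp', PNat.mul_coe, degFr_frobHom, degFr_frobHom] at hd
  exact PNat.coe_inj.1 ((Nat.prime_dvd_prime_iff_eq hp hq).1 (Dvd.intro _ hd))

/-- **[FrdI] Prop. 1.10 (iv) for `C`: "an anchor is never isotropic"** — an object of `C` with naively
isotropic region is not an anchor of `C` (`D` totally epimorphic). [cite: MochizukiFrdII2008, Prop 3.5 (ii) p.34] -/
theorem not_isAnchor_of_isotropic (hTE : IsTotallyEpimorphic D) (X : C π) (hX : X.fst.IsNaivelyIsotropic) :
    ¬ IsAnchor X := by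
  intro hfin
  let P : ℕ → ℕ+ := fun n => ⟨Nat.nth Nat.Prime n, (Nat.prime_nth_prime n).pos⟩
  have hP : ∀ n, ((P n : ℕ+) : ℕ).Prime := fun n => Nat.prime_nth_prime n
  let g : ℕ → Quotient (isIsomorphicSetoid (Under X)) := fun n => Quotient.mk _ (Under.mk (frobHom π X (P n)))
  have hg : Function.Injective g := by
    intro m n hmn
    obtain ⟨e⟩ := Quotient.exact hmn
    have hPmn : P m = P n := eq_of_under_iso_C π X (hP m) (hP n) e
    have : Nat.nth Nat.Prime m = Nat.nth Nat.Prime n := congrArg (fun k : ℕ+ => (k : ℕ)) hPmn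
    exact Nat.nth_injective Nat.infinite_setOf_prime this
  refine Set.infinite_of_injective_forall_mem hg (fun n => ?_) hfin
  exact ⟨Under.mk (frobHom π X (P n)), isIrreducibleHom_frobHom π hTE X hX (P n) (hP n), rfl⟩

/-- **[FrdI] Rmk. 3.1.1 for `C`** ("a subanchor is never isotropic; an iso-subanchor is never
isotropic"), with naive isotropy. [cite: MochizukiFrdII2008, Prop 3.5 (ii) p.34] -/
theorem not_isNaivelyIsotropic_of_isIsoSubanchor (hTE : IsTotallyEpimorphic D) (A : C π)
    (h : IsIsoSubanchor A) : ¬ A.fst.IsNaivelyIsotropic := by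
  obtain ⟨B, G, f, ⟨B', hB', ⟨g⟩⟩, hf⟩ := h
  intro hA
  have hB : B.fst.IsNaivelyIsotropic := isNaivelyIsotropic_of_monoMinimalQuotient π G f hf hA
  exact not_isAnchor_of_isotropic π hTE B' (C0.isNaivelyIsotropic_of_hom g.fst hB) hB'

/-- **Prop. 3.5 (ii) for `C = C^ℤ`, direction «iso-subanchor ⇒ non-isotropic»** (PROVED for `D` totally
epimorphic; isotropy in the sense of [FrdI] Def. 1.2 (iv) via Ex. 3.3 (ii)).
[cite: MochizukiFrdII2008, Prop 3.5 (ii) p.34] -/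
theorem isoSubanchor_not_isotropic_C (hTE : IsTotallyEpimorphic D) (A : C π) (h : IsIsoSubanchor A) :
    ¬ PreFrobenioid.IsIsotropic (C.toElem π) A :=
  fun hA => not_isNaivelyIsotropic_of_isIsoSubanchor π hTE A h ((Ex33ii_isotropic_iff_holds π A).1 hA)

/-! ### `F = A` -/

namespace A

/-- Different prime degrees give non-isomorphic objects under `X` (in `A` itself).
[cite: MochizukiFrdII2008, Prop 3.5 (ii) p.34] -/
theorem eq_of_under_iso_A (X : A π) {p q : ℕ+} (hp : (p : ℕ).Prime) (hq : (q : ℕ).Prime)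
    (e : Under.mk (frobHom π X p) ≅ Under.mk (frobHom π X q)) : p = q := by
  have w := Under.w e.hom
  have hd := congrArg (fun k => (C0.degFr k.1.fst : ℕ)) w
  change (C0.degFr ((ArchFrd.frobHom π X.obj p) ≫ e.hom.right.1).fst : ℕ) =
    (C0.degFr (ArchFrd.frobHom π X.obj q).fst : ℕ) at hd
  rw [CFP.comp_fst, C0.degFr_comp', PNat.mul_coe, degFr_frobHom, degFr_frobHom] at hd
  exact PNat.coe_inj.1 ((Nat.prime_dvd_prime_iff_eq hp hq).1 (Dvd.intro _ hd))

/-- **[FrdI] Prop. 1.10 (iv) for `A`**: an object with naively isotropic region is not an anchor of `A`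
(`D` totally epimorphic). [cite: MochizukiFrdII2008, Prop 3.5 (ii) p.34] -/
theorem not_isAnchor_of_isotropic (hTE : IsTotallyEpimorphic D) (X : A π) (hX : X.obj.fst.IsNaivelyIsotropic) :
    ¬ IsAnchor X := by
  intro hfin
  let P : ℕ → ℕ+ := fun n => ⟨Nat.nth Nat.Prime n, (Nat.prime_nth_prime n).pos⟩
  have hP : ∀ n, ((P n : ℕ+) : ℕ).Prime := fun n => Nat.prime_nth_prime n
  let g : ℕ → Quotient (isIsomorphicSetoid (Under X)) := fun n => Quotient.mk _ (Under.mk (frobHom π X (P n)))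
  have hg : Function.Injective g := by
    intro m n hmn
    obtain ⟨e⟩ := Quotient.exact hmn
    have hPmn : P m = P n := eq_of_under_iso_A π X (hP m) (hP n) e
    have : Nat.nth Nat.Prime m = Nat.nth Nat.Prime n := congrArg (fun k : ℕ+ => (k : ℕ)) hPmn
    exact Nat.nth_injective Nat.infinite_setOf_prime this
  refine Set.infinite_of_injective_forall_mem hg (fun n => ?_) hfin
  exact ⟨Under.mk (frobHom π X (P n)), isIrreducibleHom_frobHom π hTE X hX (P n) (hP n), rfl⟩

/-- **[FrdI] Rmk. 3.1.1 for `A`**, with naive isotropy. [cite: MochizukiFrdII2008, Prop 3.5 (ii) p.34] -/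
theorem not_isNaivelyIsotropic_of_isIsoSubanchor (hTE : IsTotallyEpimorphic D) (X : A π)
    (h : IsIsoSubanchor X) : ¬ X.obj.fst.IsNaivelyIsotropic := by
  obtain ⟨B, G, f, ⟨B', hB', ⟨g⟩⟩, hf⟩ := h
  intro hX
  have hB : B.obj.fst.IsNaivelyIsotropic := isNaivelyIsotropic_of_monoMinimalQuotient π G f hf hX
  exact not_isAnchor_of_isotropic π hTE B' (C0.isNaivelyIsotropic_of_hom g.1.fst hB) hB'

end A

/-- **Prop. 3.5 (ii) for the angular Frobenioid `A`, direction «iso-subanchor ⇒ non-isotropic»**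
(PROVED for `D` totally epimorphic; isotropy via Ex. 3.3 (iii), abc-iut-L1-t6's `Ex33iii_isotropic_iff_holds`).
[cite: MochizukiFrdII2008, Prop 3.5 (ii) p.34] -/
theorem isoSubanchor_not_isotropic_A (hTE : IsTotallyEpimorphic D) (X : A π) (h : IsIsoSubanchor X) :
    ¬ PreFrobenioid.IsIsotropic (A.toElem π) X :=
  fun hX => A.not_isNaivelyIsotropic_of_isIsoSubanchor π hTE X h
    ((Ex33ii_isotropic_iff_holds π X.obj).1 ((Ex33iii_isotropic_iff_holds π X).1 hX))

end ArchFrd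

end

end Literature.AlgebraicGeometry.Frobenioids
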